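import Mathlib
import Summits.NavierStokesRegularity.NavierStokesRegularity.Theorems.EulerZoomLiouvillePowerGaugeEulerLiouvilleChiralAnchorFlow
import HarnessLib

/-!
# Crux `EulerZoomLiouville.PowerGaugeEulerLiouville` (stmt-NavierStokesRegularity-19832), width sub-line `chiral_anchor` (ns-idea-11 g10, REV3),
# stub K1 `stub_anchorFlow` — part (b): TUBE TRANSPORT along the anchor flow, and THE K1 FILLER

Seat ns-ezl-w3 g8 (`--supports stmt-NavierStokesRegularity-19832 --as helper`).  Continues `…ChiralAnchorFlow.lean` (K1a, `ChiralAnchor.isAnchorFlow`).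
For the anchor flow `X r = Ψ_{max t₁ (min r t₀)}` (cut-off flow anchored at `t₀`) the TRANSPORTED CUT-OFFS are `χ' r := χ ∘ Ψ_{r → t₀}`
(`Ψ_{r→t₀} = ODE.evolutionMap (φ • u) r t₀`, the inverse of `X r`):

* `ChiralAnchor.tubeTransport_at` — for each `r ∈ [t₁,t₀]`: `χ' r` is a tube datum for `u r` of radius `R₀ + B(t₀−t₁)` (smooth, `|χ'| ≤ 1`, first
  integral `Dχ'[curl u(r)] = 0` by the LOCAL Cauchy formula `HelicityTube.curl_flow_eq_local` on the good labels), `χ' r (X r y) = χ y`, `{χ' r ≠ 0} ⊆ X r '' {χ ≠ 0}`,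
  and Moffatt's invariance `∫ χ' ⟪u(r), curl u(r)⟫ = ∫ χ ⟪u(t₀), curl u(t₀)⟫` (`HelicityTube.integral_inner_flow_eq_local` with the divergence-free test field
  `χ' · curl u(r)` + `setIntegral_image_cutoffFlow_eq`) — the argument of `HelicityTube.tubesPersist_of_driftingPastWith_free` with the slab bound in
  place of the drift envelope;
* ★ `ChiralAnchor.stub_anchorFlow_filler : <Sig.stub_anchorFlow of Lines/chiral_anchor.lean, δ-unfolded VERBATIM>` — classical members HAVE ANCHOR
  FLOWS on every velocity-bounded slab (LEAD: `exact ChiralAnchor.stub_anchorFlow_filler`).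

HONEST FRAMING: K1 is kinematic bookkeeping (S/M port) for a width sub-line of the MODEL-lattice crux class; the line's heart K4 `stub_anchorRace`
stays open; nothing about the crux E (19832 OPEN) or NS regularity is proved; not E. [cite: MajdaBertozziCUP2002, §1.6 Props. 1.8, 1.10–1.11; Moffatt1969, §3]
-/

noncomputable section

set_option linter.dupNamespace false

open MeasureTheory Set Filter Topology Metric Function InnerProductSpace
open scoped RealInnerProductSpace NNReal ENNReal ContDiff Topology

namespace Summit.NavierStokesRegularity.NavierStokesRegularity.Theorems.PowerGaugeEulerLiouville.ChiralAnchor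

open Literature.Analysis Literature.Analysis.FluidPDE Literature.Analysis.ODE
open Summit.NavierStokesRegularity.NavierStokesRegularity.Theorems.PowerGaugeEulerLiouville
open Summit.NavierStokesRegularity.NavierStokesRegularity.Theorems.PowerGaugeEulerLiouville.HelicityTube
  (curl_flow_eq_local integral_inner_flow_eq_local setIntegral_image_cutoffFlow_eq)
open Summit.NavierStokesRegularity.NavierStokesRegularity.Theorems.PowerGaugeEulerLiouville.AnchoredBudget
  (isSmoothSpaceTimeOn_cutoff isUniformlyLipschitzOn_cutoff hasDerivAt_cutoffFlow_of_mem)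

variable {u : ℝ → EuclideanSpace ℝ (Fin 3) → EuclideanSpace ℝ (Fin 3)} {p : ℝ → EuclideanSpace ℝ (Fin 3) → ℝ}
  {t₁ t₀ B R₀ : ℝ} {φ : ContDiffBump (0 : EuclideanSpace ℝ (Fin 3))}

/-- **Tube transport at one time** `r ∈ [t₁,t₀]` of a tube datum `(χ, R₀)` of the slice `u t₀` by the cut-off flow (`φ.rIn = R₀ + 3B(t₀−t₁) + 2`):
`χ' = χ ∘ Ψ_{r→t₀}` is a tube datum for `u r` of radius `R₀ + B(t₀−t₁)`, equals `χ` along the anchor trajectories, vanishes off the image of `{χ ≠ 0}`,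
and has the same Moffatt helicity. [cite: MajdaBertozziCUP2002, §1.6 Prop. 1.8 eq. (1.51), Props. 1.10–1.11; Moffatt1969, §3] -/
theorem tubeTransport_at (hcl : IsClassicalEulerSolutionOn (Iio 0) 0 u p) (ht : t₁ < t₀) (ht₀ : t₀ < 0)
    (hB : ∀ r ∈ Icc t₁ t₀, ∀ x : EuclideanSpace ℝ (Fin 3), ‖u r x‖ ≤ B) (hφ : φ.rIn = R₀ + 3 * (B * (t₀ - t₁)) + 2)
    {χ : EuclideanSpace ℝ (Fin 3) → ℝ} (hχs : ContDiff ℝ ∞ χ) (hχ1 : ∀ x, |χ x| ≤ 1) (hχ0 : ∀ x, R₀ ≤ ‖x‖ → χ x = 0)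
    (hχi : ∀ x, fderiv ℝ χ x (curl (u t₀) x) = 0) {r : ℝ} (hr : r ∈ Icc t₁ t₀) :
    (ContDiff ℝ ∞ (χ ∘ ODE.evolutionMap (fun t x => (φ : EuclideanSpace ℝ (Fin 3) → ℝ) x • u t x) r t₀) ∧
      (∀ x, |(χ ∘ ODE.evolutionMap (fun t x => (φ : EuclideanSpace ℝ (Fin 3) → ℝ) x • u t x) r t₀) x| ≤ 1) ∧
      (∀ x, R₀ + B * (t₀ - t₁) ≤ ‖x‖ → (χ ∘ ODE.evolutionMap (fun t x => (φ : EuclideanSpace ℝ (Fin 3) → ℝ) x • u t x) r t₀) x = 0) ∧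
      (∀ x, fderiv ℝ (χ ∘ ODE.evolutionMap (fun t x => (φ : EuclideanSpace ℝ (Fin 3) → ℝ) x • u t x) r t₀) x (curl (u r) x) = 0)) ∧
    (∀ y, (χ ∘ ODE.evolutionMap (fun t x => (φ : EuclideanSpace ℝ (Fin 3) → ℝ) x • u t x) r t₀)
        (ODE.evolutionMap (fun t x => (φ : EuclideanSpace ℝ (Fin 3) → ℝ) x • u t x) t₀ r y) = χ y) ∧
    (∀ x, (χ ∘ ODE.evolutionMap (fun t x => (φ : EuclideanSpace ℝ (Fin 3) → ℝ) x • u t x) r t₀) x ≠ 0 →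
        x ∈ ODE.evolutionMap (fun t x => (φ : EuclideanSpace ℝ (Fin 3) → ℝ) x • u t x) t₀ r ''
          {x : EuclideanSpace ℝ (Fin 3) | χ x ≠ 0}) ∧
    ∫ x, (χ ∘ ODE.evolutionMap (fun t x => (φ : EuclideanSpace ℝ (Fin 3) → ℝ) x • u t x) r t₀) x * ⟪u r x, curl (u r) x⟫ =
      ∫ x, χ x * ⟪u t₀ x, curl (u t₀) x⟫ := by
  obtain ⟨hSo, hSc, hS0, -, ht₀S, hIcc⟩ := window_facts ht ht₀
  have hSU : UniqueDiffOn ℝ (Ioo (t₁ - 1) (t₀ / 2)) := hSo.uniqueDiffOn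
  have hclS : IsClassicalEulerSolutionOn (Ioo (t₁ - 1) (t₀ / 2)) 0 u p := hcl.mono hS0 hSU
  have hrS : r ∈ Ioo (t₁ - 1) (t₀ / 2) := hIcc hr
  have hIrS : Icc r t₀ ⊆ Ioo (t₁ - 1) (t₀ / 2) := fun σ hσ => hIcc ⟨hr.1.trans hσ.1, hσ.2⟩
  have hB0 : 0 ≤ B := (norm_nonneg _).trans (hB t₀ (right_mem_Icc.2 ht.le) 0)
  set D : ℝ := B * (t₀ - t₁) with hDdef
  have hD0 : 0 ≤ D := mul_nonneg hB0 (by linarith)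
  have hsmw := isSmoothSpaceTimeOn_cutoff hclS.smooth_velocity φ
  have hLip := isUniformlyLipschitzOn_cutoff hclS.smooth_velocity hSU φ
  set X2 : ℝ → EuclideanSpace ℝ (Fin 3) → EuclideanSpace ℝ (Fin 3) :=
    ODE.evolutionMap (fun t x => (φ : EuclideanSpace ℝ (Fin 3) → ℝ) x • u t x) r with hX2def
  set X : EuclideanSpace ℝ (Fin 3) → EuclideanSpace ℝ (Fin 3) := X2 t₀ with hXdef
  set Y : EuclideanSpace ℝ (Fin 3) → EuclideanSpace ℝ (Fin 3) :=
    ODE.evolutionMap (fun t x => (φ : EuclideanSpace ℝ (Fin 3) → ℝ) x • u t x) t₀ r with hYdef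
  have hX2s : IsSmoothSpaceTimeOn (Ioo (t₁ - 1) (t₀ / 2)) X2 := isSmoothSpaceTimeOn_evolutionMap hLip hsmw hSc hSU hrS
  have hXs : ContDiff ℝ ∞ X := contDiff_evolutionMap_slice hLip hsmw hSc hSU hrS ht₀S
  have hX20 : X2 r = id := funext fun a => ODE.evolutionMap_self _ r a
  have hYX : ∀ a, Y (X a) = a := fun a => hLip.evolutionMap_symm hSc hrS ht₀S a
  have hXY : ∀ x, X (Y x) = x := fun x => hLip.evolutionMap_symm hSc ht₀S hrS x
  have htrans : ∀ σ ∈ Ioo (t₁ - 1) (t₀ / 2), ∀ a,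
      X2 σ a = ODE.evolutionMap (fun t x => (φ : EuclideanSpace ℝ (Fin 3) → ℝ) x • u t x) t₀ σ (X a) :=
    fun σ hσ a => (hLip.evolutionMap_trans hSc hrS ht₀S hσ a).symm
  -- confinement (K1a)
  have hback : ∀ x, ∀ σ ∈ Icc r t₀,
      ‖ODE.evolutionMap (fun t x => (φ : EuclideanSpace ℝ (Fin 3) → ℝ) x • u t x) t₀ σ x - x‖ ≤ D := fun x σ hσ =>
    norm_flow_sub_le (φ := φ) hcl ht ht₀ hB x ⟨hr.1.trans hσ.1, hσ.2⟩
  have hconf : ∀ x, ‖Y x - x‖ ≤ D := fun x => hback x r ⟨le_rfl, hr.2⟩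
  have hXa : ∀ a, ‖X a - a‖ ≤ D := fun a => by
    have h := hconf (X a); rw [hYX] at h; rw [← norm_neg, neg_sub]; exact h
  have hXfar : ∀ a : EuclideanSpace ℝ (Fin 3), R₀ + D ≤ ‖a‖ → R₀ ≤ ‖X a‖ := by
    intro a ha
    have h2 : ‖a‖ - ‖X a‖ ≤ ‖a - X a‖ := norm_sub_norm_le a (X a)
    have h3 : ‖a - X a‖ ≤ D := by rw [← norm_neg, neg_sub]; exact hXa a
    linarith
  -- GOOD labels stay in the plateau on `[r, t₀]`
  have hgood : ∀ a : EuclideanSpace ℝ (Fin 3), ‖a‖ < R₀ + D + 1 → ∀ σ ∈ Icc r t₀,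
      X2 σ a ∈ ball (0 : EuclideanSpace ℝ (Fin 3)) φ.rIn := by
    intro a ha σ hσ
    rw [htrans σ (hIrS hσ) a, hφ, mem_ball_zero_iff]
    have h1 := hback (X a) σ hσ
    have h2 : ‖X a‖ ≤ ‖a‖ + D := by linarith [norm_le_norm_add_norm_sub' (X a) a, hXa a]
    calc ‖ODE.evolutionMap (fun t x => (φ : EuclideanSpace ℝ (Fin 3) → ℝ) x • u t x) t₀ σ (X a)‖
        ≤ ‖X a‖ + ‖ODE.evolutionMap (fun t x => (φ : EuclideanSpace ℝ (Fin 3) → ℝ) x • u t x) t₀ σ (X a) - X a‖ :=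
          norm_le_norm_add_norm_sub' _ _
      _ ≤ ‖a‖ + D + D := by linarith
      _ < R₀ + 3 * (B * (t₀ - t₁)) + 2 := by rw [← hDdef]; linarith
  have hgoodOpen : IsOpen {a : EuclideanSpace ℝ (Fin 3) | ‖a‖ < R₀ + D + 1} := isOpen_lt continuous_norm continuous_const
  have hXu : ∀ a : EuclideanSpace ℝ (Fin 3), ‖a‖ < R₀ + D + 1 → ∀ σ ∈ Icc r t₀,
      ∀ᶠ a' in 𝓝 a, HasDerivAt (fun r' => X2 r' a') (u σ (X2 σ a')) σ := by
    intro a ha σ hσ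
    filter_upwards [hgoodOpen.mem_nhds ha] with a' ha'
    exact hasDerivAt_cutoffFlow_of_mem hclS.smooth_velocity hSc hSU φ hrS (hSo.mem_nhds (hIrS hσ))
      (ball_subset_closedBall (hgood a' ha' σ hσ))
  -- the LOCAL Cauchy formula on the good labels
  have hcauchy : ∀ a : EuclideanSpace ℝ (Fin 3), ‖a‖ < R₀ + D + 1 → curl (u t₀) (X a) = fderiv ℝ X a (curl (u r) a) :=
    fun a ha => curl_flow_eq_local hclS hSo hX2s hr.2 hIrS hX20 a (hXu a ha)
  have hur : ContDiff ℝ ∞ (u r) := hcl.contDiff_velocity (lt_of_le_of_lt hr.2 ht₀)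
  have hcurlr : ContDiff ℝ ∞ (curl (u r)) := contDiff_curl (n := ⊤) (hur.of_le (by exact_mod_cast le_top))
  -- the transported cut-off
  set χ' : EuclideanSpace ℝ (Fin 3) → ℝ := χ ∘ X with hχ'def
  have hχ's : ContDiff ℝ ∞ χ' := hχs.comp hXs
  have hχ'0 : ∀ a : EuclideanSpace ℝ (Fin 3), R₀ + D ≤ ‖a‖ → χ' a = 0 := fun a ha => by
    rw [hχ'def, Function.comp_apply]
    exact hχ0 (X a) (hXfar a ha)
  have hχ'i : ∀ a : EuclideanSpace ℝ (Fin 3), fderiv ℝ χ' a (curl (u r) a) = 0 := by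
    intro a
    by_cases ha : ‖a‖ < R₀ + D + 1
    · have hd1 : DifferentiableAt ℝ χ (X a) := (hχs.differentiable (by simp)) (X a)
      have hd2 : DifferentiableAt ℝ X a := (hXs.differentiable (by simp)) a
      rw [hχ'def, fderiv_comp a hd1 hd2, ContinuousLinearMap.comp_apply, ← hcauchy a ha]
      exact hχi (X a)
    · have hfar : χ' =ᶠ[𝓝 a] fun _ => 0 := by
        have hopen : IsOpen {a' : EuclideanSpace ℝ (Fin 3) | R₀ + D < ‖a'‖} := isOpen_lt continuous_const continuous_norm
        filter_upwards [hopen.mem_nhds (show R₀ + D < ‖a‖ by rw [not_lt] at ha; linarith)] with a' ha'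
        exact hχ'0 a' (le_of_lt ha')
      rw [hfar.fderiv_eq]
      simp
  refine ⟨⟨hχ's, fun a => hχ1 (X a), hχ'0, hχ'i⟩, fun y => ?_, fun x hx => ?_, ?_⟩
  · show χ (X (Y y)) = χ y
    rw [hXY]
  · exact ⟨X x, hx, hYX x⟩
  -- ### the same Moffatt helicity
  set Bf : EuclideanSpace ℝ (Fin 3) → EuclideanSpace ℝ (Fin 3) := fun a => χ' a • curl (u r) a with hBdef
  have hBs : ContDiff ℝ ∞ Bf := hχ's.smul hcurlr
  have hBzero : ∀ a : EuclideanSpace ℝ (Fin 3), R₀ + D < ‖a‖ → Bf a = 0 := fun a ha => by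
    simp only [hBdef, hχ'0 a ha.le, zero_smul]
  have hBc : HasCompactSupport Bf := by
    refine HasCompactSupport.intro (isCompact_closedBall (0 : EuclideanSpace ℝ (Fin 3)) (R₀ + D)) fun a ha => ?_
    rw [mem_closedBall, dist_zero_right, not_le] at ha
    exact hBzero a ha
  have htsupp : tsupport Bf ⊆ closedBall (0 : EuclideanSpace ℝ (Fin 3)) (R₀ + D) := by
    refine closure_minimal (fun a ha => ?_) isClosed_closedBall
    rw [mem_closedBall, dist_zero_right]
    by_contra h
    exact ha (hBzero a (not_le.1 h))
  have hBdiv : VectorCalculus.IsDivFree Bf := by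
    intro a
    have hd1 : DifferentiableAt ℝ χ' a := (hχ's.differentiable (by simp)) a
    have hd2 : DifferentiableAt ℝ (curl (u r)) a := (hcurlr.differentiable (by simp)) a
    have hdivω : VectorCalculus.divergence (curl (u r)) a = 0 :=
      divergence_curl_eq_zero_holds (u r) (hur.of_le (by norm_cast)) a
    have hgrad' : ⟪curl (u r) a, gradient χ' a⟫ = fderiv ℝ χ' a (curl (u r) a) := by
      rw [gradient, real_inner_comm, InnerProductSpace.toDual_symm_apply]
    show VectorCalculus.divergence (fun y => χ' y • curl (u r) y) a = 0
    rw [divergence_smul_apply hd1 hd2, hdivω, mul_zero, zero_add, hgrad', hχ'i a]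
  have hK := integral_inner_flow_eq_local hclS hSo hX2s hr.2 hIrS hX20 hBs hBc hBdiv fun σ hσ a ha =>
    hXu a (by have := htsupp ha; rw [mem_closedBall, dist_zero_right] at this; linarith) σ hσ
  have hrhs : ∫ a, ⟪u r a, Bf a⟫ = ∫ a, χ' a * ⟪u r a, curl (u r) a⟫ := by
    refine integral_congr_ae (ae_of_all _ fun a => ?_)
    simp only [hBdef, real_inner_smul_right]
  set G : EuclideanSpace ℝ (Fin 3) → ℝ := fun x => χ x * ⟪u t₀ x, curl (u t₀) x⟫ with hGdef
  have hlhs : ∫ a, ⟪u t₀ (X2 t₀ a), fderiv ℝ (X2 t₀) a (Bf a)⟫ = ∫ a, G (X a) := by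
    refine integral_congr_ae (ae_of_all _ fun a => ?_)
    by_cases ha : ‖a‖ < R₀ + D + 1
    · simp only [hBdef, hGdef, map_smul, real_inner_smul_right]
      rw [← hXdef, ← hcauchy a ha, hχ'def, Function.comp_apply]
    · have h0 : χ' a = 0 := hχ'0 a (by rw [not_lt] at ha; linarith)
      have h0' : χ (X a) = 0 := by simpa [hχ'def] using h0
      simp only [hBdef, hGdef, h0, zero_smul, map_zero, inner_zero_right, h0', zero_mul]
  set A : Set (EuclideanSpace ℝ (Fin 3)) := ball 0 (R₀ + D + 1) with hAdef
  have hGzero : ∀ x : EuclideanSpace ℝ (Fin 3), R₀ ≤ ‖x‖ → G x = 0 := fun x hx => by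
    simp only [hGdef, hχ0 x hx, zero_mul]
  have hcov : ∫ a, G (X a) = ∫ x, G x := by
    have h1 : ∫ a, G (X a) = ∫ a in A, G (X a) := by
      refine (setIntegral_eq_integral_of_forall_compl_eq_zero fun a ha => ?_).symm
      rw [hAdef, mem_ball_zero_iff, not_lt] at ha
      exact hGzero (X a) (hXfar a (by linarith))
    have h2 : ∫ x, G x = ∫ x in X '' A, G x := by
      refine (setIntegral_eq_integral_of_forall_compl_eq_zero fun x hx => ?_).symm
      by_contra hG
      have hxR : ‖x‖ < R₀ := by by_contra h'; exact hG (hGzero x (not_lt.1 h'))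
      apply hx
      refine ⟨Y x, ?_, hXY x⟩
      rw [hAdef, mem_ball_zero_iff]
      linarith [norm_le_norm_add_norm_sub' (Y x) x, hconf x]
    have h3 : ∫ x in X '' A, G x = ∫ a in A, G (X a) :=
      setIntegral_image_cutoffFlow_eq hclS hSc hSU φ hrS ht₀S measurableSet_ball
        (fun ξ hξ σ hσ => hgood ξ (mem_ball_zero_iff.1 hξ) σ (by rwa [uIcc_of_le hr.2] at hσ)) G
    rw [h1, h2, h3]
  have hfin : ∫ a, χ' a * ⟪u r a, curl (u r) a⟫ = ∫ x, G x := by rw [← hrhs, ← hK, hlhs, hcov]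
  simpa only [hGdef] using hfin

/-- ★ **K1 `stub_anchorFlow` (= `Sig.stub_anchorFlow` of `Lines/chiral_anchor.lean`, δ-unfolded VERBATIM): classical members HAVE ANCHOR FLOWS on every
velocity-bounded slab.**  For `t₁ < t₀ < 0`, the slab bound `‖u‖ ≤ B` on `[t₁,t₀] × ℝ³` and a tube datum `(χ,R)` of `u t₀`: the anchor flow is
`X r := Ψ_{max t₁ (min r t₀)}` (cut-off flow of `φ • u`, `φ.rIn = R + 3B(t₀−t₁) + 2`, anchored at `t₀`; `ChiralAnchor.isAnchorFlow`) and the tube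
transport is `χ' r := χ ∘ Ψ_{max t₁ (min r t₀) → t₀}` (`ChiralAnchor.tubeTransport_at`).  LEAD: `exact ChiralAnchor.stub_anchorFlow_filler`.
[cite: MajdaBertozziCUP2002, §1.3 Prop. 1.4, §1.6 Props. 1.8, 1.10–1.11; Moffatt1969, §3] -/
theorem stub_anchorFlow_filler :
    ∀ (u : ℝ → EuclideanSpace ℝ (Fin 3) → EuclideanSpace ℝ (Fin 3)) (p : ℝ → EuclideanSpace ℝ (Fin 3) → ℝ),
      IsClassicalEulerSolutionOn (Set.Iio 0) 0 u p →
        ∀ t₀ : ℝ, t₀ < 0 → ∀ t₁ : ℝ, t₁ < t₀ →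
          (∃ B : ℝ, ∀ r ∈ Set.Icc t₁ t₀, ∀ x : EuclideanSpace ℝ (Fin 3), ‖u r x‖ ≤ B) →
            ∀ (χ : EuclideanSpace ℝ (Fin 3) → ℝ) (R : ℝ), 0 < R →
              (ContDiff ℝ ∞ χ ∧ (∀ x : EuclideanSpace ℝ (Fin 3), |χ x| ≤ 1) ∧ (∀ x : EuclideanSpace ℝ (Fin 3), R ≤ ‖x‖ → χ x = 0) ∧
                ∀ x : EuclideanSpace ℝ (Fin 3), fderiv ℝ χ x (curl (u t₀) x) = 0) →
              ∃ (X : ℝ → EuclideanSpace ℝ (Fin 3) → EuclideanSpace ℝ (Fin 3)) (χ' : ℝ → EuclideanSpace ℝ (Fin 3) → ℝ),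
                (Continuous (fun q : ℝ × EuclideanSpace ℝ (Fin 3) => X q.1 q.2) ∧
                  (∀ y ∈ {x : EuclideanSpace ℝ (Fin 3) | χ x ≠ 0}, X t₀ y = y) ∧
                  (∀ r ∈ Set.Icc t₁ t₀, ∀ y ∈ {x : EuclideanSpace ℝ (Fin 3) | χ x ≠ 0},
                    HasDerivWithinAt (fun σ : ℝ => X σ y) (u r (X r y)) (Set.Icc t₁ t₀) r) ∧
                  (∀ r ∈ Set.Icc t₁ t₀, Set.InjOn (X r) {x : EuclideanSpace ℝ (Fin 3) | χ x ≠ 0}) ∧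
                  (∀ r ∈ Set.Icc t₁ t₀, ∀ S ⊆ {x : EuclideanSpace ℝ (Fin 3) | χ x ≠ 0}, MeasurableSet S →
                    MeasurableSet (X r '' S) ∧ volume (X r '' S) = volume S) ∧
                  (∀ r ∈ Set.Icc t₁ t₀, ∀ S ⊆ {x : EuclideanSpace ℝ (Fin 3) | χ x ≠ 0}, MeasurableSet S →
                    ∀ g : EuclideanSpace ℝ (Fin 3) → ℝ≥0∞, Measurable g → ∫⁻ x in X r '' S, g x = ∫⁻ y in S, g (X r y)) ∧
                  (∃ R' : ℝ, ∀ r ∈ Set.Icc t₁ t₀, X r '' {x : EuclideanSpace ℝ (Fin 3) | χ x ≠ 0} ⊆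
                    Metric.ball (0 : EuclideanSpace ℝ (Fin 3)) R')) ∧
                (χ' t₀ = χ ∧
                  ∀ r ∈ Set.Icc t₁ t₀,
                    (∃ R' : ℝ, 0 < R' ∧ (ContDiff ℝ ∞ (χ' r) ∧ (∀ x : EuclideanSpace ℝ (Fin 3), |χ' r x| ≤ 1) ∧
                      (∀ x : EuclideanSpace ℝ (Fin 3), R' ≤ ‖x‖ → χ' r x = 0) ∧
                      ∀ x : EuclideanSpace ℝ (Fin 3), fderiv ℝ (χ' r) x (curl (u r) x) = 0)) ∧
                    (∀ y ∈ {x : EuclideanSpace ℝ (Fin 3) | χ x ≠ 0}, χ' r (X r y) = χ y) ∧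
                    (∀ x : EuclideanSpace ℝ (Fin 3), χ' r x ≠ 0 → x ∈ X r '' {x : EuclideanSpace ℝ (Fin 3) | χ x ≠ 0}) ∧
                    ∫ x, χ' r x * inner ℝ (u r x) (curl (u r) x) = ∫ x, χ x * inner ℝ (u t₀ x) (curl (u t₀) x)) := by
  intro u p hcl t₀ ht₀ t₁ ht hBex χ R hR hχ
  obtain ⟨B, hB⟩ := hBex
  obtain ⟨hχs, hχ1, hχ0, hχi⟩ := hχ
  have hB0 : 0 ≤ B := (norm_nonneg _).trans (hB t₀ (right_mem_Icc.2 ht.le) 0)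
  have hD0 : 0 ≤ B * (t₀ - t₁) := mul_nonneg hB0 (by linarith)
  obtain ⟨φ, hφ⟩ : ∃ φ : ContDiffBump (0 : EuclideanSpace ℝ (Fin 3)), φ.rIn = R + 3 * (B * (t₀ - t₁)) + 2 :=
    ⟨⟨R + 3 * (B * (t₀ - t₁)) + 2, R + 3 * (B * (t₀ - t₁)) + 3, by linarith, by linarith⟩, rfl⟩
  have hT : {x : EuclideanSpace ℝ (Fin 3) | χ x ≠ 0} ⊆ ball (0 : EuclideanSpace ℝ (Fin 3)) R := fun x hx => by
    rw [mem_ball_zero_iff]; by_contra h; exact hx (hχ0 x (not_lt.1 h))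
  have hclamp_id : ∀ r ∈ Icc t₁ t₀, max t₁ (min r t₀) = r := fun r hr => by
    rw [min_eq_left hr.2, max_eq_right hr.1]
  refine ⟨fun r y => ODE.evolutionMap (fun t x => (φ : EuclideanSpace ℝ (Fin 3) → ℝ) x • u t x) t₀ (max t₁ (min r t₀)) y,
    fun r x => χ (ODE.evolutionMap (fun t x => (φ : EuclideanSpace ℝ (Fin 3) → ℝ) x • u t x) (max t₁ (min r t₀)) t₀ x),
    isAnchorFlow hcl ht ht₀ hB hφ hT, ?_, fun r hr => ?_⟩
  · funext x
    show χ (ODE.evolutionMap _ (max t₁ (min t₀ t₀)) t₀ x) = χ x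
    rw [min_self, max_eq_right ht.le, ODE.evolutionMap_self]
  · obtain ⟨hdat, halong, himg, hhel⟩ := tubeTransport_at hcl ht ht₀ hB hφ hχs hχ1 hχ0 hχi hr
    simp only [hclamp_id r hr]
    exact ⟨⟨R + B * (t₀ - t₁), by linarith, hdat⟩, fun y _ => halong y, himg, hhel⟩

end Summit.NavierStokesRegularity.NavierStokesRegularity.Theorems.PowerGaugeEulerLiouville.ChiralAnchor

end
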